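import Mathlib
import Summits.Ventures.PercRepro2.LocRows
import Summits.Ventures.PercRepro2.SwRow
import Summits.Ventures.PercRepro2.SwOut
import Summits.Ventures.PercRepro2.SwAllRow
import Summits.Ventures.PercRepro2.SwOutAll
import Summits.Ventures.PercRepro2.SwOutArmFlip
import Summits.Ventures.PercRepro2.SwOutArmThm
import Summits.Ventures.PercRepro2.SwOutCoreDefs
import Summits.Ventures.PercRepro2.SwOutCoreHull
import Summits.Ventures.PercRepro2.SwOutCoreDual
import Summits.Ventures.PercRepro2.SwOutCoreKey
import Summits.Ventures.PercRepro2.SwOutShadowDefs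
import Summits.Ventures.PercRepro2.SwOutShadowCube
import Summits.Ventures.PercRepro2.SwOutShadowIneq
import Summits.Ventures.PercRepro2.SwOutCoreShadowDefs
import Summits.Ventures.PercRepro2.SwOutCoreShadowKey
import Summits.Ventures.PercRepro2.SwOutJunction
import Summits.Ventures.PercRepro2.SwOutJunctionRegion
import Summits.Ventures.PercRepro2.SwOutJunctionH1Defs
import Summits.Ventures.PercRepro2.SwOutJunctionH1Arms
import Summits.Ventures.PercRepro2.SwOutEdgeDefs
import Summits.Ventures.PercRepro2.SwOutEdgeBase
import Summits.Ventures.PercRepro2.SwOutEdgeKey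
import Summits.Ventures.PercRepro2.SwOutEdgeShadow
import Summits.Ventures.PercRepro2.SwOutEdgeShadowFlip
import Summits.Ventures.PercRepro2.SwOutEdgeToggle
import Summits.Ventures.PercRepro2.SwOutEdgeShadowArm
import Summits.Ventures.PercRepro2.SwOutEdgeShadowEsc
import Summits.Ventures.PercRepro2.SwOutEdgeShadowKey

/-!
# The shadow kind of the adjacent case (blind cell PercRepro2, night-4 g16, 2026-08-26;
proofs/NIGHT4-G16.md §4)

`SwOutCoreShadowKind` for an e-core base (the junction `u` adjacent to `h`): the SHADOW DATA of a
key `(b, S, R)` (`ShadowDataE`: the arms, the e-core base in the class, the one-sided point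
«no blue h-arm adjacent to `u`» with a dropped arm, the canonical form of `R`), the SHADOW KIND
(`ShadowKindE`: the key of `ζ` carries shadow data and `ζ` lies in its block), the constancy of
the key along a shadow block (`shadowKindE_of_mem_shadowBlock`), the canonical form of the red
arms (`hR_of_mem_shadowBlockE`) and the rigid inequality on a shadow block
(`shadowBlockE_card_le'`, from `shadowBlockE_card_le`).
-/

namespace Summit.Ventures.PercRepro2

namespace LocRows

open Hull

variable {V : Type*} {E : Type*} [Fintype E] [DecidableEq E]

open scoped Classical

variable {ends : E → Sym2 V}

/-- **Shadow data** of a key `(b, S, R)` in the adjacent case: the arms, the e-core base in the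
class, the one-sided point (no blue h-arm adjacent to `u`) with a dropped arm, and the canonical
form of `R`. -/
structure ShadowDataE (ends : E → Sym2 V) (U : Set V) (ξ : Config E) (h u : V) (b : Config E)
    (S R : Finset (Set V)) : Prop where
  hS : S = armsC ends h u b
  hb : CoreBaseE ends b h u (extHull ends b h u) (armsFun S) (pureFun ends h S)
  hHU : extHull ends b h u ⊆ U
  hbcl : b ∈ outClass ends U h ξ
  huB : ¬ uRed ends (armsFun S) u (pureFun ends h S) (flipAll (omegaSR S R))
  hZ : ∃ P : S, uAdjC ends u (armsFun S) P ∧ omegaSR S R P = false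
  hR : R = S.filter fun P => (∃ e x, ends e = s(u, x) ∧ x ∈ P) → P ∈ R

/-- **The shadow kind** of the adjacent case: the key of `ζ` carries shadow data and `ζ` lies in
its block. -/
def ShadowKindE (ends : E → Sym2 V) (U : Set V) (ξ : Config E) (h u : V) (ζ : Config E) : Prop :=
  ShadowDataE ends U ξ h u (baseOfE ends h u ζ) (armsOf ends h u ζ) (redOf ends h u ζ) ∧
    ζ ∈ shadowBlock ends u (baseOfE ends h u ζ) (armsOf ends h u ζ) (redOf ends h u ζ)

section Kind

variable {U : Set V} {ξ : Config E} {l h o u : V} {b : Config E} {S R : Finset (Set V)}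

/-- **The constancy of the key along a shadow block**: a `Q`-point of the shadow block of a key
with shadow data is of the shadow kind with that key, lies in the class, and is escaping. -/
theorem shadowKindE_of_mem_shadowBlock (hl : l ∉ U)
    (hout : ∀ x ∈ U, x ≠ h → x ≠ o → x ≠ u →
      (∃ e y, ends e = s(x, y) ∧ y ∉ U) ∨ (∀ e, x ∉ ends e))
    (hd : ShadowDataE ends U ξ h u b S R) {ζ' : Config E} (hζ' : ζ' ∈ shadowBlock ends u b S R)
    (hQ : ζ' ∈ tgtU ends l h {T : Set V | o ∈ T}) :
    baseOfE ends h u ζ' = b ∧ armsOf ends h u ζ' = S ∧ redOf ends h u ζ' = R ∧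
      ShadowKindE ends U ξ h u ζ' ∧ ζ' ∈ swOutSide ends l h o U ξ ∧ u ∈ hull ends ζ' h ∧
      ¬ hull ends ζ' u ⊆ U := by
  have h1 := baseOfE_of_mem_shadowBlock hd.hS hd.hb hd.huB hζ'
  have h2 := armsOf_of_mem_shadowBlockE hd.hS hd.hb hd.huB hζ'
  have h3 : redOf ends h u ζ' = R := by
    rw [redOf_of_mem_shadowBlockE hd.hS hd.hb hd.huB hζ', ← hd.hR]
  refine ⟨h1, h2, h3, ⟨by rw [h1, h2, h3]; exact hd, by rw [h1, h2, h3]; exact hζ'⟩, ?_,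
    u_mem_hull_of_mem_shadowBlockE hd.hb hd.huB hζ',
    not_hull_u_subset_of_mem_shadowBlockE hl hout hd.hHU hd.hb hd.huB hd.hZ hζ' hQ⟩
  exact mem_swOutSide.2 ⟨hQ, mem_outClass_of_mem_shadowBlockE hd.hHU hd.hb hd.huB hd.hbcl hζ'⟩

omit [DecidableEq E] in
/-- The canonical form of the red arms of a point of a shadow block. -/
theorem hR_of_mem_shadowBlockE (hS : S = armsC ends h u b)
    (hb : CoreBaseE ends b h u (extHull ends b h u) (armsFun S) (pureFun ends h S))
    (huB : ¬ uRed ends (armsFun S) u (pureFun ends h S) (flipAll (omegaSR S R)))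
    {ζ : Config E} (hζ : ζ ∈ shadowBlock ends u b S R) (hRζ : R = redOf ends h u ζ) :
    R = S.filter fun P => (∃ e x, ends e = s(u, x) ∧ x ∈ P) → P ∈ R := by
  exact hRζ.trans (redOf_of_mem_shadowBlockE hS hb huB hζ)

/-- **The rigid inequality on a shadow block with shadow data.** -/
theorem shadowBlockE_card_le' (hl : l ∉ U) (hd : ShadowDataE ends U ξ h u b S R)
    {𝓔 : Set (Set E)} (h𝓔 : IsUpperSet 𝓔) :
    ((shadowBlock ends u b S R).filter fun ζ' =>
        ζ' ∈ tgtU ends l h {T : Set V | o ∈ T} ∧ redEdges ends ζ' h ∈ 𝓔).card ≤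
      ((shadowBlock ends u b S R).filter fun ζ' =>
        ζ' ∈ tgtU ends l h {T : Set V | o ∈ T} ∧ blueEdges ends ζ' h ∈ 𝓔).card :=
  shadowBlockE_card_le (o := o) hl hd.hHU hd.hb hd.huB h𝓔

end Kind

end LocRows

end Summit.Ventures.PercRepro2
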